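import Mathlib
import HarnessLib
import Summits.ResolutionOfSingularities.ResolutionOfSingularities.Theorems.WildQuotientsWildQuotientResolutionS1KillExitDefsTame
import Summits.ResolutionOfSingularities.ResolutionOfSingularities.Theorems.WildQuotientsWildQuotientResolutionS1aGameFrameWFFrom
import Summits.ResolutionOfSingularities.ResolutionOfSingularities.Theorems.WildQuotientsWildQuotientResolutionS1aEndGluing

/-!
# S1a — stub `stub_frameAssembly` of line `s1a-logminvertex` v4 CLOSED (by name): the frame assembly

[OURS · L1 W4.5c · lead-1 g6] — NOT a statement of the manuscript; counted 0; AI-level work, weaker than expert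
review. Crux stmt-ResolutionOfSingularities-17941 (`WildQuotients.CyclicQuotientFourfolds`), skeleton
`Cruxes/CyclicQuotientFourfolds/Lines/s1a_logminvertex.lean` v4 «GLOBAL FRAME» (plan-1 g11, registered 23:05:43Z).
M-sized GLUE over the landed frame: for a datum of `S1.GlobalKillTame p` derive the instances (`IsAffineHom q`,
`IsSeparated q` from `IsFinite q`; `X₁.IsSeparated` from `IsSeparated f`; `IsLocallyNoetherian X′` from finite type),
pick a generator `g₀` of the cyclic `G` (`Nat.card G = p` prime), take the initial node atlas and the strategy from the
initial model, and apply the tree capstone `GameFrame.killTameModel_of_blowupNodeAtlas_wfFrom` with the end gluing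
`GameFrame.endGluing` (G5, p577057).
-/

set_option linter.dupNamespace false

noncomputable section

open CategoryTheory CategoryTheory.Limits AlgebraicGeometry TopologicalSpace
open Literature.AlgebraicGeometry.Resolution Literature.AlgebraicGeometry.RelativeSpec
open Summit.ResolutionOfSingularities.ResolutionOfSingularities.Theorems.WildQuotientResolution
open Summit.ResolutionOfSingularities.ResolutionOfSingularities.Theorems.WildQuotientResolution.S1.NodeAtlas
open Summit.ResolutionOfSingularities.ResolutionOfSingularities.Theorems.WildQuotientResolution.S1.MoveStep
open Summit.ResolutionOfSingularities.ResolutionOfSingularities.Theorems.WildQuotientResolution.S1.GameFrame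

namespace Summit.ResolutionOfSingularities.ResolutionOfSingularities.Theorems.WildQuotientResolution.S1

/-- **`stub_frameAssembly` (line `s1a-logminvertex` v4)**: blow-up node atlas + initial node atlas + a well-founded
strategy from the initial model of every datum ⇒ `S1.GlobalKillTame p`. [OURS · L1 W4.5c] -/
theorem stub_frameAssembly :
    ∀ p : ℕ, p.Prime → BlowupNodeAtlas.{0} p →
      (∀ {X' X₁ : Scheme.{0}} (q : X' ⟶ X₁) (G : Type) [Group G] [Finite G]
        (ρ : G →* Aut X') (g₀ : G), g₀ ^ p = 1 → ∀ (hq : ∀ g : G, (ρ g).hom ≫ q = q)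
        [X₁.IsSeparated] [IsAffineHom q] [IsLocallyNoetherian X'], Scheme.IsRegular X' →
        NodeAtlas p (⟨ρ, hq⟩ : ActionOver q G) g₀) →
      (∀ (k : Type) [Field k] [CharP k p] [PerfectField k] (X' X₁ : Scheme.{0})
        (f : X₁ ⟶ Spec (.of k)) (q : X' ⟶ X₁) (G : Type) [Group G] [Finite G]
        (ρ : G →* Aut X'), Nat.card G = p → IsSeparated f → LocallyOfFiniteType f → QuasiCompact f →
        IsIntegral X₁ → ∀ [IsIntegral X'], Scheme.IsRegular X' → IsFinite q → Function.Surjective q.base →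
        (∃ U : X₁.Opens, Dense (U : Set X₁) ∧ Etale (q ∣_ U)) →
        ∀ (hq : ∀ g : G, (ρ g).hom ≫ q = q),
        (∀ x y : X', q.base x = q.base y → ∃ g : G, (ρ g).hom.base x = y) →
        topologicalKrullDim X₁ ≤ 4 → Function.Injective ρ →
        ∀ (g₀ : G), (∀ g : G, g ∈ Subgroup.zpowers g₀) → ∀ [IsLocallyNoetherian X']
          (h₀ : NodeAtlas p (⟨ρ, hq⟩ : ActionOver q G) g₀),
          StrategyWFFrom p q G ρ g₀ (GModel.initial hq h₀)) →
      S1.GlobalKillTame p := by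
  intro p hp hcharts hinit hstrat k _ _ _ X' X₁ f q G _ _ ρ hcard hfsep hfft hfqc hX₁ hX' hreg hqfin hsurj hU hq
    horb hdim hinj
  classical
  haveI := hfsep
  haveI := hfft
  haveI := hfqc
  haveI := hX₁
  haveI := hX'
  haveI := hqfin
  haveI : X₁.IsSeparated := ⟨by rw [← terminal.comp_from f]; infer_instance⟩
  haveI : IsLocallyNoetherian X₁ := LocallyOfFiniteType.isLocallyNoetherian f
  haveI : IsLocallyNoetherian X' := LocallyOfFiniteType.isLocallyNoetherian q
  haveI : Fact p.Prime := ⟨hp⟩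
  haveI : IsCyclic G := isCyclic_of_prime_card hcard
  obtain ⟨g₀, hg₀⟩ := IsCyclic.exists_generator (α := G)
  have hg₀p : g₀ ^ p = 1 := by rw [← hcard]; exact pow_card_eq_one'
  have h₀ : NodeAtlas p (⟨ρ, hq⟩ : ActionOver q G) g₀ := hinit q G ρ g₀ hg₀p hq hreg
  exact killTameModel_of_blowupNodeAtlas_wfFrom hg₀ hcharts endGluing
    (hstrat k X' X₁ f q G ρ hcard hfsep hfft hfqc hX₁ hreg hqfin hsurj hU hq horb hdim hinj g₀ hg₀ h₀)

end Summit.ResolutionOfSingularities.ResolutionOfSingularities.Theorems.WildQuotientResolution.S1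

end
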